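import Literature.Computability.AlgebraicComplexity.ProjectedShiftedPartialsLower
import HarnessLib

/-!
# The lower-bound skeleton `T₁, T₂, T₃ ⟹ Φ` (Kumar–Saraf 2017, §5.1 and §8.5, proof of Lemma 8.9)

Topic `Literature/Computability/AlgebraicComplexity`; infrastructure for the printed proof of
`kumarSaraf2017_imm_homDepthFour` (`HomogeneousDepthFour.lean`). This file assembles the generic
lower-bound tools of `ProjectedShiftedPartialsLower.lean` (Lemma 5.1, Lemma 5.3, Lemma 3.8) into
the deterministic implication used in the proof of [KS, Lemma 8.9]: for a polynomial `f`, order-`r`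
derivative operators `α = Ls i`, a "good" set `𝒢` of them, and a shift degree `m`, IF

* (`T₁`) for every `α ∈ 𝒢`, `∑_{β ∈ supp ∂_α f} |S_m(α, β)| ≥ t₁`,
* (`T₂`) for every `α ∈ 𝒢`, `∑_{β ≠ β'} |S_m(α,β) ∩ S_m(α,β')| ≤ λ₂ ∑_β |S_m(α,β)|`,
* (`T₃`) `∑_{(α,β) ≠ (α',β')} |A_m(α,β) ∩ A_m(α',β')| ≤ λ₃ ∑_{α ∈ 𝒢, β} |A_m(α, β)|`,

and every `∂_α f` has multilinear monomials, THEN `(λ₂ + 1)(λ₃ + 1) · Φ_{ℳ,m}(f) ≥ |𝒢| · t₁`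
(`pspDim_mul_ge_of_T123`; print: "Lemma 3.8 will then imply that `|⋃ A_m(α, β)|` is large. Hence,
by Lemma 5.1, `Φ_{𝒢,m}` is large", with `1/(4λ)` for our `1/(λ+1)`).

Everything is proved (D-0026: no named facts); the IMM-specific verification of `T₁, T₂, T₃`
(§8.7, §9) is not in this file.

## References

* M. Kumar, S. Saraf, *On the power of homogeneous depth 4 arithmetic circuits*, SIAM J. Comput.
  46 (2017) 336–387 (arXiv:1404.1950): §5.1, §8.5, Lemmas 8.8–8.9.
-/

noncomputable section

open MvPolynomial

namespace Literature.Computability.AlgebraicComplexity.KumarSaraf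

open GKKS

variable {K : Type*} [Field K] {σ : Type*} [Fintype σ] [DecidableEq σ]

/-- **Step 1 of the proof of Lemma 8.9** (per derivative operator): if `∂_α f` has multilinear
monomials, `∑_β |S_m(α,β)| ≥ t₁` and `∑_{β ≠ β'} |S_m(α,β) ∩ S_m(α,β')| ≤ λ₂ ∑_β |S_m(α,β)|`, then
`(λ₂ + 1) ∑_β |A_m(α,β)| ≥ t₁` (Lemma 3.8, then Lemma 5.3). [cite: KumarSaraf2017, Lemma 8.9] -/
theorem sum_card_aSet_mul_ge (mo : MonomialOrder σ) (g : MvPolynomial σ K)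
    (hg : ∀ β ∈ g.support, IsML β) (m t₁ lam₂ : ℕ)
    (hT₁ : t₁ ≤ ∑ β ∈ g.support, (sSet m β).card)
    (hT₂ : ∑ β ∈ g.support, ∑ β' ∈ g.support.erase β, (sSet m β ∩ sSet m β').card ≤
      lam₂ * ∑ β ∈ g.support, (sSet m β).card) :
    t₁ ≤ (lam₂ + 1) * ∑ β ∈ g.support, (aSet K mo g m β).card := by
  classical
  have h1 := card_biUnion_ge_of_sum_inter_le g.support (sSet m) lam₂ hT₂
  have h2 := card_biUnion_sSet_le_sum_card_aSet mo g hg m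
  calc t₁ ≤ ∑ β ∈ g.support, (sSet m β).card := hT₁
    _ ≤ (lam₂ + 1) * (g.support.biUnion (sSet m)).card := h1
    _ ≤ (lam₂ + 1) * ∑ β ∈ g.support, (aSet K mo g m β).card := Nat.mul_le_mul_left _ h2

/-- **Kumar–Saraf 2017, §8.5 / proof of Lemma 8.9: `T₁, T₂, T₃ ⟹ Φ` (deterministic skeleton).**
Let `f` be a polynomial, `Ls` a family of derivative operators, `𝒢` a finite set of them such that
every `∂_{Ls i} f` (`i ∈ 𝒢`) has multilinear monomials, and `m` a shift degree. If for every
`i ∈ 𝒢`, `∑_β |S_m(β)| ≥ t₁` and `∑_{β≠β'} |S_m(β) ∩ S_m(β')| ≤ λ₂ ∑_β |S_m(β)|` (sums over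
`β ∈ supp ∂_{Ls i} f`), and if over the pairs `p = (i, β)`
`∑_{p ≠ q} |A_m(p) ∩ A_m(q)| ≤ λ₃ ∑_p |A_m(p)|`, then
`(λ₂ + 1)(λ₃ + 1) · Φ_{ℳ,m}(f) ≥ |𝒢| · t₁` — Lemma 3.8 twice, Lemma 5.3, and Lemma 5.1
(`Φ ≥ |⋃_p A_m(p)|`). [cite: KumarSaraf2017, Lemma 8.9] -/
theorem pspDim_mul_ge_of_T123 {ι : Type*} [Fintype ι] [DecidableEq ι] (mo : MonomialOrder σ)
    (Ls : ι → List σ) (m : ℕ) (f : MvPolynomial σ K) (G : Finset ι)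
    (hML : ∀ i ∈ G, ∀ β ∈ (iterPderiv (Ls i) f).support, IsML β) (t₁ lam₂ lam₃ : ℕ)
    (hT₁ : ∀ i ∈ G, t₁ ≤ ∑ β ∈ (iterPderiv (Ls i) f).support, (sSet m β).card)
    (hT₂ : ∀ i ∈ G, ∑ β ∈ (iterPderiv (Ls i) f).support,
        ∑ β' ∈ (iterPderiv (Ls i) f).support.erase β, (sSet m β ∩ sSet m β').card ≤
      lam₂ * ∑ β ∈ (iterPderiv (Ls i) f).support, (sSet m β).card)
    (hT₃ : ∑ p ∈ G.sigma fun i => (iterPderiv (Ls i) f).support,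
        ∑ q ∈ (G.sigma fun i => (iterPderiv (Ls i) f).support).erase p,
          (aSet K mo (iterPderiv (Ls p.1) f) m p.2 ∩ aSet K mo (iterPderiv (Ls q.1) f) m q.2).card ≤
      lam₃ * ∑ p ∈ G.sigma fun i => (iterPderiv (Ls i) f).support,
        (aSet K mo (iterPderiv (Ls p.1) f) m p.2).card) :
    G.card * t₁ ≤ (lam₂ + 1) * (lam₃ + 1) * pspDim Ls m f := by
  classical
  set P := G.sigma fun i => (iterPderiv (Ls i) f).support with hP
  set A : (Σ _ : ι, σ →₀ ℕ) → Finset (σ →₀ ℕ) :=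
    fun p => aSet K mo (iterPderiv (Ls p.1) f) m p.2 with hA
  -- Step 1, summed over `𝒢`
  have step1 : G.card * t₁ ≤ (lam₂ + 1) * ∑ p ∈ P, (A p).card := by
    rw [hP, Finset.sum_sigma, Finset.mul_sum, Finset.card_eq_sum_ones, Finset.sum_mul]
    refine Finset.sum_le_sum fun i hi => ?_
    rw [one_mul]
    exact sum_card_aSet_mul_ge mo _ (hML i hi) m t₁ lam₂ (hT₁ i hi) (hT₂ i hi)
  -- Step 2: Lemma 3.8 over the pairs, then Lemma 5.1
  have step2 : ∑ p ∈ P, (A p).card ≤ (lam₃ + 1) * (P.biUnion A).card :=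
    card_biUnion_ge_of_sum_inter_le P A lam₃ hT₃
  have step3 : (P.biUnion A).card ≤ pspDim Ls m f := by
    have h := card_biUnion_aSet_le_pspDim (K := K) mo Ls m f G
      (fun i => (iterPderiv (Ls i) f).support)
    convert h using 2
    ext δ
    simp only [hP, hA, Finset.mem_biUnion, Finset.mem_sigma]
    constructor
    · rintro ⟨⟨i, β⟩, ⟨hi, hβ⟩, hδ⟩
      exact ⟨i, hi, β, hβ, hδ⟩
    · rintro ⟨i, hi, β, hβ, hδ⟩
      exact ⟨⟨i, β⟩, ⟨hi, hβ⟩, hδ⟩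
  calc G.card * t₁ ≤ (lam₂ + 1) * ∑ p ∈ P, (A p).card := step1
    _ ≤ (lam₂ + 1) * ((lam₃ + 1) * (P.biUnion A).card) := Nat.mul_le_mul_left _ step2
    _ ≤ (lam₂ + 1) * ((lam₃ + 1) * pspDim Ls m f) :=
        Nat.mul_le_mul_left _ (Nat.mul_le_mul_left _ step3)
    _ = (lam₂ + 1) * (lam₃ + 1) * pspDim Ls m f := by ring

end Literature.Computability.AlgebraicComplexity.KumarSaraf

end
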